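import Literature.MathematicalPhysics.QuantumFieldTheory.SchwingerLimitInheritance
import Literature.MathematicalPhysics.QuantumFieldTheory.OSData
import Literature.MathematicalPhysics.QuantumLattice.SchwartzOrderedWedgeDensity
import Literature.MathematicalPhysics.QuantumLattice.SchwingerOSCluster
import HarnessLib

/-!
# The full-spectrum mass gap of OS data from the Cauchy–Schwarz bound on slab-ordered product tensors

Topic `MathematicalPhysics/QuantumFieldTheory` (families `constructive-qft`, `yang-mills`); theorem-only
sequel of `MassGapTimeOrderedDetermined` (the mass-gap clause is decided on time-ordered test
functions) and `SchwartzOrderedWedgeDensity` (slab-ordered real product tensors are total among them);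
consumed by `MassGapFromLatticeClustering` (the lattice-facing transfer).

`OSData.HasMassGap T Δ` (Jaffe–Witten's "`H` has no spectrum in `(0, Δ)`" on the FULL reconstructed
space) asks, for ALL time-ordered `F, G`, a per-pair constant `C(F, G)` with
`|𝔖(ΘF* ⊗ T_t G) − 𝔖(ΘF*) 𝔖(G)| ≤ C e^{−Δt}`.  Per-pair constants survive limits / density
arguments only as CONTINUOUS functionals of the test functions; the transfer-matrix (spectral) bound
has exactly that form, `|⟨F̂Ω, (e^{−tH} − |Ω⟩⟨Ω|) ĜΩ⟩| ≤ e^{−Δt} ‖F̂Ω‖ ‖ĜΩ‖` with the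
reflection-positive norms `‖F̂Ω‖² = 𝔖₂ₙ(ΘF* ⊗ F)`.  This file proves:

* `OSData.truncated_eq_zero_left/right` — in degree `0` (either slot) the truncated quantity of the
  clause vanishes identically (E4 along a spatial direction + E1), any `d ≥ 2`;
* `OSData.hasMassGap_of_csBound_span` — if the Cauchy–Schwarz bound with the reflection-positive
  norms holds for `F`, `G` in the `ℂ`-spans of `slabOrderedProducts d n`, `slabOrderedProducts d m`
  (`n, m ≥ 1`) at all `t ≥ 0`, then `T.HasMassGap Δ` (both sides are continuous in `(F, G)`;
  ordered-wedge density `IsTimeOrdered.mem_closure_span_slabOrderedProducts`);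
* kinematic lemmas: sesquilinear expansions `apply_osAdjoint_appendTensor_sum_smul`,
  `apply_osAdjoint_sum_smul`, `apply_sum_smul`; `translateMulti_of_isEmpty`.

References: K. Osterwalder, R. Schrader, CMP 31 (1973) §2–§4 [OsterwalderSchraderCMP1973];
J. Glimm, A. Jaffe, *Quantum Physics* (1987) §6.1 (Thm. 6.1.3), §19.7 [GlimmJaffeQP1987];
A. Jaffe, E. Witten, *Quantum Yang–Mills theory* (2000) §4 [JaffeWitten2000].
Mathlib: `closure_prod_eq`, `isClosed_le`.  Tree: `osAdjoint_sum/smul`,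
`SchwartzMap.appendTensor_sum_left/right`, `continuous_appendTensor`, `continuous_osAdjoint`,
`OSReconstructionNoE1.isTimeOrdered_translateMulti`, `…isOffDiagonal_appendTensor_osAdjoint`,
`IsTimeOrdered.mem_closure_span_slabOrderedProducts`, `translateMulti_appendTensor`.
-/

open scoped SchwartzMap ComplexConjugate
open Filter Topology Complex Set
open Literature.MathematicalPhysics.AQFT Literature.MathematicalPhysics.QuantumLattice

noncomputable section

namespace Literature.MathematicalPhysics.QuantumFieldTheory

variable {d : ℕ} [NeZero d] {n m : ℕ}

/-! ### Kinematics: sesquilinear expansions, empty slots -/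

/-- Sesquilinear expansion of `S(Θ(∑ᵢ aᵢFᵢ)* ⊗ ∑ⱼ bⱼGⱼ)` for a linear functional `S` (`osAdjoint` is
conjugate-linear, `appendTensor` bilinear). [folklore] -/
theorem apply_osAdjoint_appendTensor_sum_smul
    (S : 𝓢((Fin (n + m) → EuclideanSpace ℝ (Fin d)), ℂ) →L[ℂ] ℂ) {ι' κ : Type*} (s : Finset ι')
    (u : Finset κ) (a : ι' → ℂ) (b : κ → ℂ) (F : ι' → 𝓢((Fin n → EuclideanSpace ℝ (Fin d)), ℂ))
    (G : κ → 𝓢((Fin m → EuclideanSpace ℝ (Fin d)), ℂ)) :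
    S ((osAdjoint (∑ i ∈ s, a i • F i)).appendTensor (∑ j ∈ u, b j • G j)) =
      ∑ i ∈ s, ∑ j ∈ u, conj (a i) * b j * S ((osAdjoint (F i)).appendTensor (G j)) := by
  rw [osAdjoint_sum, SchwartzMap.appendTensor_sum_left, map_sum]
  refine Finset.sum_congr rfl fun i _ => ?_
  rw [SchwartzMap.appendTensor_sum_right, map_sum]
  refine Finset.sum_congr rfl fun j _ => ?_
  rw [osAdjoint_smul, SchwartzMap.appendTensor_smul_left, SchwartzMap.appendTensor_smul_right,
    map_smul, map_smul, smul_eq_mul, smul_eq_mul]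
  ring

/-- Conjugate-linear expansion of `S(Θ(∑ᵢ aᵢFᵢ)*)`. [folklore] -/
theorem apply_osAdjoint_sum_smul (S : 𝓢((Fin n → EuclideanSpace ℝ (Fin d)), ℂ) →L[ℂ] ℂ)
    {ι' : Type*} (s : Finset ι') (a : ι' → ℂ) (F : ι' → 𝓢((Fin n → EuclideanSpace ℝ (Fin d)), ℂ)) :
    S (osAdjoint (∑ i ∈ s, a i • F i)) = ∑ i ∈ s, conj (a i) * S (osAdjoint (F i)) := by
  rw [osAdjoint_sum, map_sum]
  refine Finset.sum_congr rfl fun i _ => ?_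
  rw [osAdjoint_smul, map_smul, smul_eq_mul]

omit [NeZero d] in
/-- Linear expansion of `S(∑ⱼ bⱼGⱼ)`. [folklore] -/
theorem apply_sum_smul (S : 𝓢((Fin m → EuclideanSpace ℝ (Fin d)), ℂ) →L[ℂ] ℂ) {κ : Type*}
    (u : Finset κ) (b : κ → ℂ) (G : κ → 𝓢((Fin m → EuclideanSpace ℝ (Fin d)), ℂ)) :
    S (∑ j ∈ u, b j • G j) = ∑ j ∈ u, b j * S (G j) := by
  rw [map_sum]
  refine Finset.sum_congr rfl fun j _ => ?_
  rw [map_smul, smul_eq_mul]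

omit [NeZero d] in
/-- A translate of a test function in NO variable is itself. [folklore] -/
theorem translateMulti_of_isEmpty [IsEmpty (Fin n)] (a : EuclideanSpace ℝ (Fin d))
    (F : 𝓢((Fin n → EuclideanSpace ℝ (Fin d)), ℂ)) : translateMulti a F = F := by
  ext x
  rw [translateMulti_apply]
  exact congrArg F (Subsingleton.elim _ _)

omit [NeZero d] in
/-- The witness `H` of `IsAppendTensorOf H F G` is the tree's `F.appendTensor G`. [folklore] -/
theorem eq_appendTensor_of_isAppendTensorOf' {H : 𝓢((Fin (n + m) → EuclideanSpace ℝ (Fin d)), ℂ)}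
    {F : 𝓢((Fin n → EuclideanSpace ℝ (Fin d)), ℂ)} {G : 𝓢((Fin m → EuclideanSpace ℝ (Fin d)), ℂ)}
    (hH : IsAppendTensorOf H F G) : H = F.appendTensor G := by
  ext x; rw [hH x, SchwartzMap.appendTensor_apply]

/-- Joint continuity of `(F, G) ↦ ΘF* ⊗ T_a G`. [folklore] -/
theorem continuous_osAdjoint_appendTensor_translateMulti' (a : EuclideanSpace ℝ (Fin d)) :
    Continuous fun p : 𝓢((Fin n → EuclideanSpace ℝ (Fin d)), ℂ) ×
        𝓢((Fin m → EuclideanSpace ℝ (Fin d)), ℂ) =>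
      (osAdjoint p.1).appendTensor (translateMulti a p.2) :=
  continuous_appendTensor.comp ((continuous_osAdjoint.comp continuous_fst).prodMk
    ((translateMulti a).continuous.comp continuous_snd))

/-! ### Degree zero: the truncated quantity vanishes (E4 + E1) -/

namespace OSData

variable {ι : Type}

/-- **Degree zero, left slot.** For `F` in no variable, `G` time-ordered, `t ≥ 0` and a spatial
direction `a ≠ 0` (so `d ≥ 2`): `𝔖_{0+m}(ΘF* ⊗ T_t G) = 𝔖₀(ΘF*) 𝔖ₘ(G)` — E4 along `a` for the pair
`(F, T_t G)` is a CONSTANT sequence (the empty slot carries no variable, E1), and E1 removes `T_t`.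
[cite: OsterwalderSchraderCMP1973, §3 (E1), (E4)] -/
theorem truncated_eq_zero_left (T : OSData ι d) (k : Fin 0 → ι) (k' : Fin m → ι)
    (F : 𝓢((Fin 0 → EuclideanSpace ℝ (Fin d)), ℂ)) (G : 𝓢((Fin m → EuclideanSpace ℝ (Fin d)), ℂ))
    (hF : IsTimeOrdered F) (hG : IsTimeOrdered G) {a : EuclideanSpace ℝ (Fin d)} (ha0 : a 0 = 0)
    (ha : a ≠ 0) {t : ℝ} (ht : 0 ≤ t) :
    T.schwinger (0 + m) (Fin.append (k ∘ Fin.rev) k')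
        ((osAdjoint F).appendTensor (translateMulti (EuclideanSpace.single 0 t) G)) -
      T.schwinger 0 (k ∘ Fin.rev) (osAdjoint F) * T.schwinger m k' G = 0 := by
  set Gt := translateMulti (EuclideanSpace.single (0 : Fin d) t) G
  have hGt : IsTimeOrdered Gt := OSReconstructionNoE1.isTimeOrdered_translateMulti hG (by simp [ht])
  have hX : IsOffDiagonal ((osAdjoint F).appendTensor Gt) :=
    OSReconstructionNoE1.isOffDiagonal_appendTensor_osAdjoint hF hGt
  have hE4 := T.cluster 0 m k k' F Gt hF hGt a ha0 ha
    (fun s => (osAdjoint F).appendTensor (translateMulti (s • a) Gt))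
    (fun s => isAppendTensorOf_appendTensor _ _)
  have hconst : ∀ s : ℝ, T.schwinger (0 + m) (Fin.append (k ∘ Fin.rev) k')
      ((osAdjoint F).appendTensor (translateMulti (s • a) Gt)) =
      T.schwinger (0 + m) (Fin.append (k ∘ Fin.rev) k') ((osAdjoint F).appendTensor Gt) := by
    intro s
    have h1 : (osAdjoint F).appendTensor (translateMulti (s • a) Gt) =
        translateMulti (s • a) ((osAdjoint F).appendTensor Gt) := by
      rw [translateMulti_appendTensor, translateMulti_of_isEmpty (s • a) (osAdjoint F)]
    rw [h1]
    exact T.invariant.translateMulti (0 + m) _ (s • a) _ hX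
  simp_rw [hconst] at hE4
  rw [← T.invariant.translateMulti m k' (EuclideanSpace.single (0 : Fin d) t) G hG.isOffDiagonal]
  exact tendsto_nhds_unique tendsto_const_nhds hE4

/-- **Degree zero, right slot.** For `G` in no variable: `𝔖_{n+0}(ΘF* ⊗ T_t G) = 𝔖ₙ(ΘF*) 𝔖₀(G)`.
[cite: OsterwalderSchraderCMP1973, §3 (E1), (E4)] -/
theorem truncated_eq_zero_right (T : OSData ι d) (k : Fin n → ι) (k' : Fin 0 → ι)
    (F : 𝓢((Fin n → EuclideanSpace ℝ (Fin d)), ℂ)) (G : 𝓢((Fin 0 → EuclideanSpace ℝ (Fin d)), ℂ))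
    (hF : IsTimeOrdered F) (hG : IsTimeOrdered G) {a : EuclideanSpace ℝ (Fin d)} (ha0 : a 0 = 0)
    (ha : a ≠ 0) (t : ℝ) :
    T.schwinger (n + 0) (Fin.append (k ∘ Fin.rev) k')
        ((osAdjoint F).appendTensor (translateMulti (EuclideanSpace.single 0 t) G)) -
      T.schwinger n (k ∘ Fin.rev) (osAdjoint F) * T.schwinger 0 k' G = 0 := by
  rw [translateMulti_of_isEmpty]
  have hE4 := T.cluster n 0 k k' F G hF hG a ha0 ha
    (fun s => (osAdjoint F).appendTensor (translateMulti (s • a) G))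
    (fun s => isAppendTensorOf_appendTensor _ _)
  simp_rw [translateMulti_of_isEmpty] at hE4
  exact tendsto_nhds_unique tendsto_const_nhds hE4

/-! ### The Cauchy–Schwarz bound on the span of slab-ordered product tensors suffices -/

/-- **Full-spectrum gap from the Cauchy–Schwarz bound on the spans** (`d ≥ 2`).  If for all
`n, m ≥ 1`, all label strings and all `F ∈ span(slabOrderedProducts d n)`,
`G ∈ span(slabOrderedProducts d m)`, `t ≥ 0`,
`‖𝔖_{n+m}(ΘF* ⊗ T_t G) − 𝔖ₙ(ΘF*) 𝔖ₘ(G)‖ ≤ e^{−Δt} √‖𝔖₂ₙ(ΘF* ⊗ F)‖ √‖𝔖₂ₘ(ΘG* ⊗ G)‖`,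
then `T.HasMassGap Δ`: the constant `C(F, G) = √‖𝔖₂ₙ(ΘF* ⊗ F)‖ √‖𝔖₂ₘ(ΘG* ⊗ G)‖` is jointly
continuous, the truncated quantity is continuous in `(F, G)` at fixed `t`, and the spans are dense in
the time-ordered test functions (ordered-wedge density); degree `0` by `truncated_eq_zero_left/right`.
[cite: GlimmJaffeQP1987, §6.1 Thm. 6.1.3 and §19.7] [cite: OsterwalderSchraderCMP1973, §2 pp. 86–87] -/
theorem hasMassGap_of_csBound_span (T : OSData ι d) (hd : 1 < d) (Δ : ℝ)
    (h : ∀ (n m : ℕ), n ≠ 0 → m ≠ 0 → ∀ (k : Fin n → ι) (k' : Fin m → ι)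
      (F : 𝓢((Fin n → EuclideanSpace ℝ (Fin d)), ℂ)) (G : 𝓢((Fin m → EuclideanSpace ℝ (Fin d)), ℂ)),
      F ∈ Submodule.span ℂ (slabOrderedProducts d n) → G ∈ Submodule.span ℂ (slabOrderedProducts d m) →
      ∀ t : ℝ, 0 ≤ t →
        ‖T.schwinger (n + m) (Fin.append (k ∘ Fin.rev) k')
              ((osAdjoint F).appendTensor (translateMulti (EuclideanSpace.single 0 t) G)) -
            T.schwinger n (k ∘ Fin.rev) (osAdjoint F) * T.schwinger m k' G‖ ≤
          Real.exp (-Δ * t) *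
            Real.sqrt ‖T.schwinger (n + n) (Fin.append (k ∘ Fin.rev) k) ((osAdjoint F).appendTensor F)‖ *
            Real.sqrt ‖T.schwinger (m + m) (Fin.append (k' ∘ Fin.rev) k') ((osAdjoint G).appendTensor G)‖) :
    T.HasMassGap Δ := by
  intro n m k k' F G hF hG
  let Φ : 𝓢((Fin n → EuclideanSpace ℝ (Fin d)), ℂ) → 𝓢((Fin m → EuclideanSpace ℝ (Fin d)), ℂ) →
      ℝ → ℂ := fun P Q t =>
    T.schwinger (n + m) (Fin.append (k ∘ Fin.rev) k')
        ((osAdjoint P).appendTensor (translateMulti (EuclideanSpace.single 0 t) Q)) -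
      T.schwinger n (k ∘ Fin.rev) (osAdjoint P) * T.schwinger m k' Q
  let Nn : 𝓢((Fin n → EuclideanSpace ℝ (Fin d)), ℂ) → ℝ := fun P =>
    Real.sqrt ‖T.schwinger (n + n) (Fin.append (k ∘ Fin.rev) k) ((osAdjoint P).appendTensor P)‖
  let Nm : 𝓢((Fin m → EuclideanSpace ℝ (Fin d)), ℂ) → ℝ := fun Q =>
    Real.sqrt ‖T.schwinger (m + m) (Fin.append (k' ∘ Fin.rev) k') ((osAdjoint Q).appendTensor Q)‖
  refine ⟨Nn F * Nm G, fun t ht H hH => ?_⟩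
  rw [eq_appendTensor_of_isAppendTensorOf' hH]
  change ‖Φ F G t‖ ≤ Nn F * Nm G * Real.exp (-Δ * t)
  have hRHS : 0 ≤ Nn F * Nm G * Real.exp (-Δ * t) :=
    mul_nonneg (mul_nonneg (Real.sqrt_nonneg _) (Real.sqrt_nonneg _)) (Real.exp_pos _).le
  -- degree zero in either slot (spatial direction `e₁`)
  have ha0 : (EuclideanSpace.single (⟨1, hd⟩ : Fin d) (1 : ℝ) : EuclideanSpace ℝ (Fin d)) 0 = 0 := by
    have h10 : (0 : Fin d) ≠ ⟨1, hd⟩ := fun h => absurd (congrArg Fin.val h) (by simp)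
    simp [h10]
  have ha : (EuclideanSpace.single (⟨1, hd⟩ : Fin d) (1 : ℝ) : EuclideanSpace ℝ (Fin d)) ≠ 0 :=
    fun h => by simpa using congrArg (fun v : EuclideanSpace ℝ (Fin d) => v ⟨1, hd⟩) h
  rcases Nat.eq_zero_or_pos n with rfl | hn
  · have h0 : Φ F G t = 0 := truncated_eq_zero_left T k k' F G hF hG ha0 ha ht
    rw [h0, norm_zero]; exact hRHS
  rcases Nat.eq_zero_or_pos m with rfl | hm
  · have h0 : Φ F G t = 0 := truncated_eq_zero_right T k k' F G hF hG ha0 ha t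
    rw [h0, norm_zero]; exact hRHS
  -- density: both sides are continuous in the pair, the bound holds on span × span
  have hΦc : Continuous fun pq : 𝓢((Fin n → EuclideanSpace ℝ (Fin d)), ℂ) ×
      𝓢((Fin m → EuclideanSpace ℝ (Fin d)), ℂ) => Φ pq.1 pq.2 t := by
    refine Continuous.sub ?_ (Continuous.mul ?_ ?_)
    · exact (T.schwinger (n + m) (Fin.append (k ∘ Fin.rev) k')).continuous.comp
        (continuous_osAdjoint_appendTensor_translateMulti' (EuclideanSpace.single 0 t))
    · exact (T.schwinger n (k ∘ Fin.rev)).continuous.comp (continuous_osAdjoint.comp continuous_fst)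
    · exact (T.schwinger m k').continuous.comp continuous_snd
  have hNnc : Continuous Nn :=
    Real.continuous_sqrt.comp (continuous_norm.comp
      ((T.schwinger (n + n) (Fin.append (k ∘ Fin.rev) k)).continuous.comp
        (continuous_appendTensor.comp (continuous_osAdjoint.prodMk continuous_id))))
  have hNmc : Continuous Nm :=
    Real.continuous_sqrt.comp (continuous_norm.comp
      ((T.schwinger (m + m) (Fin.append (k' ∘ Fin.rev) k')).continuous.comp
        (continuous_appendTensor.comp (continuous_osAdjoint.prodMk continuous_id))))
  have hclosed : IsClosed {pq : 𝓢((Fin n → EuclideanSpace ℝ (Fin d)), ℂ) ×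
      𝓢((Fin m → EuclideanSpace ℝ (Fin d)), ℂ) |
        ‖Φ pq.1 pq.2 t‖ ≤ Nn pq.1 * Nm pq.2 * Real.exp (-Δ * t)} :=
    isClosed_le (continuous_norm.comp hΦc)
      (((hNnc.comp continuous_fst).mul (hNmc.comp continuous_snd)).mul continuous_const)
  have hsub : ((Submodule.span ℂ (slabOrderedProducts d n) :
        Set 𝓢((Fin n → EuclideanSpace ℝ (Fin d)), ℂ)) ×ˢ
      (Submodule.span ℂ (slabOrderedProducts d m) :
        Set 𝓢((Fin m → EuclideanSpace ℝ (Fin d)), ℂ))) ⊆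
      {pq | ‖Φ pq.1 pq.2 t‖ ≤ Nn pq.1 * Nm pq.2 * Real.exp (-Δ * t)} := by
    intro pq hpq
    have := h n m hn.ne' hm.ne' k k' pq.1 pq.2 hpq.1 hpq.2 t ht
    simp only [Set.mem_setOf_eq, Φ, Nn, Nm]
    linarith [this]
  have hmem : (F, G) ∈ closure (((Submodule.span ℂ (slabOrderedProducts d n) :
        Set 𝓢((Fin n → EuclideanSpace ℝ (Fin d)), ℂ)) ×ˢ
      (Submodule.span ℂ (slabOrderedProducts d m) :
        Set 𝓢((Fin m → EuclideanSpace ℝ (Fin d)), ℂ)))) := by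
    rw [closure_prod_eq]
    exact ⟨hF.mem_closure_span_slabOrderedProducts, hG.mem_closure_span_slabOrderedProducts⟩
  simpa only [Set.mem_setOf_eq] using hclosed.closure_subset_iff.2 hsub hmem

end OSData

end Literature.MathematicalPhysics.QuantumFieldTheory

end
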